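import Literature.AlgebraicGeometry.Deformation.SmoothSchemeLiftObstructionCriterionGlueReduction
import HarnessLib

/-!
# Gluing the lifted charts, VII b: the chart images of the change-of-coefficients morphism are preimages
# (Hartshorne, *Deformation Theory*, proof of Thm. 10.2 (a); `X'_{R'} → X'_R` over `Spec R' → Spec R`)

Topic `Literature/AlgebraicGeometry/Deformation`; THEOREMS ONLY (no definition, no instance, no notation, no named fact, no
`sorry`).  Sequel of ★ `Deformation/SmoothSchemeLiftObstructionCriterionGlueReduction` (FILE 4b: for a `k`-algebra map
`σ : R → R'` and compatible cocycle-exact lifted gluing data `ψ` over `R`, `ψ'` over `R'` on the same principal affine cover of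
the `k`-scheme `X`, the change-of-coefficients morphism `Φ : X'_{R'} ⟶ X'_R` of the glued deformations has CARTESIAN chart
squares `Spec (R' ⊗_k Γ(U j)) → X'_{R'}`, `Spec (R ⊗_k Γ(U j)) → X'_R` — ★ `isPullback_ι_baseChangeMap`).  Here:

* §1 (generic, `Literature.AlgebraicGeometry.Morphisms`) — for a CARTESIAN square of schemes `fst ≫ f = snd ≫ g`, the range of
  `fst` is the preimage under `f` of the range of `g` ([GortzWedhorn2020] Lemma 4.28 / [StacksProject] Tag 01JT: the points of a
  fibre product surject onto the pairs of points with the same image; Mathlib `Scheme.image_preimage_eq_of_isPullback`; the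
  `Set.range` equality is the tree's `GroupSchemes.range_eq_preimage_range_of_isPullback`), pointwise
  (`mem_range_iff_of_isPullback`) and, for open immersions `fst`, `g`, on `Opens`:
  **`opensRange_eq_preimage_opensRange_of_isPullback`**.
* §2 — THE CHART IMAGES OF THE GLUED DEFORMATIONS CORRESPOND UNDER `Φ`: `(ι' j)(Spec (R' ⊗_k Γ(U j))) = Φ⁻¹ (ι j)(Spec (R ⊗_k Γ(U j)))`
  as opens of `X'_{R'}` (**`opensRange_ι_eq_preimage_baseChangeMap`**), as sets (`range_ι_eq_preimage_baseChangeMap`), and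
  pointwise (`mem_opensRange_ι_iff_baseChangeMap`) — [Hartshorne2010] proof of Thm. 10.2 (a), p. 81 («`U'_i ≅ U_i ×_k Spec A'` …
  the open covering `𝒰'` of `X'`»): the lifted charts over `R'` are the base changes of the lifted charts over `R`, so their
  images are the preimages.

Cell `hodgecm-mathlib`, F-11 road A (crux `HDel`), integrator MONO-G2 step (N3) (B-p13 (g22)): to move a frame
`𝒪^κ ≅ M|_{(ι j)(C_j)}` of a module on `X'_R` along `Φ` one needs `(ι' j)(C'_j) = Φ⁻¹ (ι j)(C_j)`.  HC_CM is proved only modulo the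
7 printed citations until rung 0 closes — nothing here bears on a summit statement.

## References
* [Hartshorne2010] R. Hartshorne, *Deformation Theory*, GTM 257, Springer (2010): Thm. 10.2 (a) and its proof (p. 81).
* [GortzWedhorn2020] U. Görtz, T. Wedhorn, *Algebraic Geometry I*, 2nd ed. (2020): Lemma 4.28 (points of fibre products, p. 109).
* [StacksProject] The Stacks Project, Tag 01JT (points of fibre products), Tag 01LH (relative glueing), Tag 01JA.
-/

noncomputable section

-- `TopCat.Presheaf`/`TopCat.Sheaf` are not reducible (as in Mathlib's `AlgebraicGeometry/Modules`).
set_option backward.isDefEq.respectTransparency false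

open CategoryTheory AlgebraicGeometry Opposite TopologicalSpace Limits
open scoped TensorProduct

universe u

/-! ## §1 Ranges in a cartesian square of schemes -/

namespace Literature.AlgebraicGeometry.Morphisms

section IsPullback

variable {P X Y Z : Scheme.{u}} {fst : P ⟶ X} {snd : P ⟶ Y} {f : X ⟶ Z} {g : Y ⟶ Z}

/-- Pointwise form of «`range fst = f⁻¹ (range g)` in a cartesian square `fst ≫ f = snd ≫ g` of schemes» (the points of
`X ×_Z Y` surject onto the pairs of points of `X` and `Y` with the same image in `Z`; Mathlib
`Scheme.image_preimage_eq_of_isPullback` at `Set.univ` — the `Set.range` equality itself is the tree's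
`GroupSchemes.range_eq_preimage_range_of_isPullback`, not restated here): `x ∈ range fst ↔ f x ∈ range g`.
[cite: GortzWedhorn2020, Lemma 4.28 (p. 109)] [cite: StacksProject, Tag 01JT] -/
theorem mem_range_iff_of_isPullback (h : IsPullback fst snd f g) (x : X) :
    x ∈ Set.range fst ↔ f x ∈ Set.range g := by
  have e := Scheme.image_preimage_eq_of_isPullback h.flip Set.univ
  simp only [Set.preimage_univ, Set.image_univ] at e
  rw [e, Set.mem_preimage]

/-- **In a cartesian square with open immersions `fst`, `g`: `fst(P) = f⁻¹ g(Y)` as OPENS of `X`** (the open-subscheme form: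
the base change of the open immersion `g` along `f` is the open immersion onto `f⁻¹ g(Y)`).
[cite: GortzWedhorn2020, Lemma 4.28 (p. 109)] [cite: StacksProject, Tag 01JT] -/
theorem opensRange_eq_preimage_opensRange_of_isPullback (h : IsPullback fst snd f g) [IsOpenImmersion fst]
    [IsOpenImmersion g] : fst.opensRange = f ⁻¹ᵁ g.opensRange := by
  ext x
  exact mem_range_iff_of_isPullback h x

end IsPullback

end Literature.AlgebraicGeometry.Morphisms

/-! ## §2 The chart images of `X'_{R'}` are the preimages under `Φ : X'_{R'} → X'_R` of the chart images of `X'_R` -/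

namespace Literature.AlgebraicGeometry.Deformation

open Literature.AlgebraicGeometry.Motives Literature.AlgebraicGeometry.Morphisms

variable {k : Type u} [Field k] {X : Over (Spec (CommRingCat.of k))}
  [instΓ : ∀ W : X.left.Opens, Algebra k Γ(X.left, W)]
  (halg : ∀ (W : X.left.Opens) (s : k), algebraMap k Γ(X.left, W) s = (constToPresheaf X).app (op W) s)
  {R R' : Type u} [CommRing R] [Algebra k R] [CommRing R'] [Algebra k R'] (σ : R →ₐ[k] R')
  {ι : Type u} (U : ι → X.left.affineOpens) (b : (j l : ι) → Γ(X.left, (U j).1))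
  (hb : ∀ j l, (U j).1 ⊓ (U l).1 = X.left.basicOpen (b j l))
  (ψ : (j l : ι) → R ⊗[k] Γ(X.left, (U j).1 ⊓ (U l).1) ≃ₐ[R] R ⊗[k] Γ(X.left, (U j).1 ⊓ (U l).1))
  (ψ' : (j l : ι) → R' ⊗[k] Γ(X.left, (U j).1 ⊓ (U l).1) ≃ₐ[R'] R' ⊗[k] Γ(X.left, (U j).1 ⊓ (U l).1))
  (𝔫 : Ideal R) (h𝔫 : IsNilpotent 𝔫) (𝔫' : Ideal R') (h𝔫' : IsNilpotent 𝔫')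
  (hψ : ∀ j l x, ψ j l x - x ∈ 𝔫 • (⊤ : Submodule R (R ⊗[k] Γ(X.left, (U j).1 ⊓ (U l).1))))
  (hψ' : ∀ j l x, ψ' j l x - x ∈ 𝔫' • (⊤ : Submodule R' (R' ⊗[k] Γ(X.left, (U j).1 ⊓ (U l).1))))
  (hcoc : ∀ (j l m : ι)
    (Φjl : R ⊗[k] Γ(X.left, (U j).1 ⊓ (U l).1) →ₐ[R] R ⊗[k] Γ(X.left, (U j).1 ⊓ (U l).1 ⊓ (U m).1))
    (_ : ∀ a s, Φjl (a ⊗ₜ s) = a ⊗ₜ X.left.presheaf.map (homOfLE inf_le_left).op s)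
    (Φlm : R ⊗[k] Γ(X.left, (U l).1 ⊓ (U m).1) →ₐ[R] R ⊗[k] Γ(X.left, (U j).1 ⊓ (U l).1 ⊓ (U m).1))
    (_ : ∀ a s, Φlm (a ⊗ₜ s) = a ⊗ₜ X.left.presheaf.map
      (homOfLE (le_inf (inf_le_left.trans inf_le_right) inf_le_right)).op s)
    (Φjm : R ⊗[k] Γ(X.left, (U j).1 ⊓ (U m).1) →ₐ[R] R ⊗[k] Γ(X.left, (U j).1 ⊓ (U l).1 ⊓ (U m).1))
    (_ : ∀ a s, Φjm (a ⊗ₜ s) = a ⊗ₜ X.left.presheaf.map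
      (homOfLE (le_inf (inf_le_left.trans inf_le_left) inf_le_right)).op s)
    (ρjl ρlm ρjm : R ⊗[k] Γ(X.left, (U j).1 ⊓ (U l).1 ⊓ (U m).1) ≃ₐ[R]
      R ⊗[k] Γ(X.left, (U j).1 ⊓ (U l).1 ⊓ (U m).1)),
    (∀ x, ρjl (Φjl x) = Φjl (ψ j l x)) → (∀ x, ρlm (Φlm x) = Φlm (ψ l m x)) →
    (∀ x, ρjm (Φjm x) = Φjm (ψ j m x)) → ρlm * ρjl = ρjm)
  (hcoc' : ∀ (j l m : ι)
    (Φjl : R' ⊗[k] Γ(X.left, (U j).1 ⊓ (U l).1) →ₐ[R'] R' ⊗[k] Γ(X.left, (U j).1 ⊓ (U l).1 ⊓ (U m).1))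
    (_ : ∀ a s, Φjl (a ⊗ₜ s) = a ⊗ₜ X.left.presheaf.map (homOfLE inf_le_left).op s)
    (Φlm : R' ⊗[k] Γ(X.left, (U l).1 ⊓ (U m).1) →ₐ[R'] R' ⊗[k] Γ(X.left, (U j).1 ⊓ (U l).1 ⊓ (U m).1))
    (_ : ∀ a s, Φlm (a ⊗ₜ s) = a ⊗ₜ X.left.presheaf.map
      (homOfLE (le_inf (inf_le_left.trans inf_le_right) inf_le_right)).op s)
    (Φjm : R' ⊗[k] Γ(X.left, (U j).1 ⊓ (U m).1) →ₐ[R'] R' ⊗[k] Γ(X.left, (U j).1 ⊓ (U l).1 ⊓ (U m).1))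
    (_ : ∀ a s, Φjm (a ⊗ₜ s) = a ⊗ₜ X.left.presheaf.map
      (homOfLE (le_inf (inf_le_left.trans inf_le_left) inf_le_right)).op s)
    (ρjl ρlm ρjm : R' ⊗[k] Γ(X.left, (U j).1 ⊓ (U l).1 ⊓ (U m).1) ≃ₐ[R']
      R' ⊗[k] Γ(X.left, (U j).1 ⊓ (U l).1 ⊓ (U m).1)),
    (∀ x, ρjl (Φjl x) = Φjl (ψ' j l x)) → (∀ x, ρlm (Φlm x) = Φlm (ψ' l m x)) →
    (∀ x, ρjm (Φjm x) = Φjm (ψ' j m x)) → ρlm * ρjl = ρjm)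
  (Φ : (deformationGlueDatum halg R' U b hb ψ' 𝔫' h𝔫' hψ' hcoc').glueData.glued ⟶
    (deformationGlueDatum halg R U b hb ψ 𝔫 h𝔫 hψ hcoc).glueData.glued)
  (hΦ : ∀ j, (deformationGlueDatum halg R' U b hb ψ' 𝔫' h𝔫' hψ' hcoc').glueData.ι j ≫ Φ =
    Spec.map (CommRingCat.ofHom (Algebra.TensorProduct.map σ (AlgHom.id k Γ(X.left, (U j).1))).toRingHom) ≫
      (deformationGlueDatum halg R U b hb ψ 𝔫 h𝔫 hψ hcoc).glueData.ι j)

include hΦ in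
/-- **THE CHART IMAGES CORRESPOND UNDER `Φ`**: `(ι' j)(Spec (R' ⊗_k Γ(U j))) = Φ⁻¹ (ι j)(Spec (R ⊗_k Γ(U j)))` as opens of
`X'_{R'}` — the chart square is cartesian (★ `isPullback_ι_baseChangeMap`) and both `ι' j`, `ι j` are open immersions (§1);
the equality sharpening the inclusion ★ `opensRange_le_preimage_baseChangeMap` of `…GlueLineBundleBaseChange`.
[cite: Hartshorne2010, Thm. 10.2 (proof), p. 81] [cite: StacksProject, Tag 01LH] -/
theorem opensRange_ι_eq_preimage_baseChangeMap (j : ι) :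
    ((deformationGlueDatum halg R' U b hb ψ' 𝔫' h𝔫' hψ' hcoc').glueData.ι j).opensRange =
      Φ ⁻¹ᵁ ((deformationGlueDatum halg R U b hb ψ 𝔫 h𝔫 hψ hcoc).glueData.ι j).opensRange :=
  opensRange_eq_preimage_opensRange_of_isPullback
    (isPullback_ι_baseChangeMap halg σ U b hb ψ ψ' 𝔫 h𝔫 𝔫' h𝔫' hψ hψ' hcoc hcoc' Φ hΦ j)

include hΦ in
/-- The same on underlying sets: `range (ι' j) = Φ⁻¹ range (ι j)`. [cite: Hartshorne2010, Thm. 10.2 (proof), p. 81]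
[cite: StacksProject, Tag 01JT] -/
theorem range_ι_eq_preimage_baseChangeMap (j : ι) :
    Set.range ((deformationGlueDatum halg R' U b hb ψ' 𝔫' h𝔫' hψ' hcoc').glueData.ι j) =
      Φ ⁻¹' Set.range ((deformationGlueDatum halg R U b hb ψ 𝔫 h𝔫 hψ hcoc).glueData.ι j) :=
  Set.ext fun x => mem_range_iff_of_isPullback
    (isPullback_ι_baseChangeMap halg σ U b hb ψ ψ' 𝔫 h𝔫 𝔫' h𝔫' hψ hψ' hcoc hcoc' Φ hΦ j) x

include hΦ in
/-- Pointwise form: a point of `X'_{R'}` lies in the `j`-th chart iff its image under `Φ` lies in the `j`-th chart of `X'_R`.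
[cite: Hartshorne2010, Thm. 10.2 (proof), p. 81] [cite: StacksProject, Tag 01JT] -/
theorem mem_opensRange_ι_iff_baseChangeMap (j : ι)
    (x : ↥(deformationGlueDatum halg R' U b hb ψ' 𝔫' h𝔫' hψ' hcoc').glueData.glued) :
    x ∈ ((deformationGlueDatum halg R' U b hb ψ' 𝔫' h𝔫' hψ' hcoc').glueData.ι j).opensRange ↔
      Φ x ∈ ((deformationGlueDatum halg R U b hb ψ 𝔫 h𝔫 hψ hcoc).glueData.ι j).opensRange := by
  rw [opensRange_ι_eq_preimage_baseChangeMap halg σ U b hb ψ ψ' 𝔫 h𝔫 𝔫' h𝔫' hψ hψ' hcoc hcoc' Φ hΦ j]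
  rfl

include hΦ in
/-- **The chart images of `X'_{R'}` cover it iff … — they always do; in particular `Φ⁻¹` of the chart cover of `X'_R` is the
chart cover of `X'_{R'}`**: `⨆ j, Φ⁻¹ (ι j)(C_j) = ⊤`. [cite: Hartshorne2010, Thm. 10.2 (proof), p. 81] [cite: StacksProject, Tag 01JA] -/
theorem iSup_preimage_opensRange_ι_baseChangeMap :
    ⨆ j, Φ ⁻¹ᵁ ((deformationGlueDatum halg R U b hb ψ 𝔫 h𝔫 hψ hcoc).glueData.ι j).opensRange = ⊤ := by
  simp_rw [← opensRange_ι_eq_preimage_baseChangeMap halg σ U b hb ψ ψ' 𝔫 h𝔫 𝔫' h𝔫' hψ hψ' hcoc hcoc' Φ hΦ]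
  exact top_le_iff.mp fun x _ => by
    obtain ⟨j, y, hy⟩ := (deformationGlueDatum halg R' U b hb ψ' 𝔫' h𝔫' hψ' hcoc').glueData.ι_jointly_surjective x
    exact Opens.mem_iSup.mpr ⟨j, ⟨y, hy⟩⟩

end Literature.AlgebraicGeometry.Deformation

end
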